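import Mathlib.Analysis.SpecialFunctions.Trigonometric.Deriv
import Mathlib.Analysis.SpecialFunctions.Trigonometric.Bounds
import Mathlib.Analysis.Complex.Trigonometric
import Mathlib.Analysis.SpecialFunctions.Pow.Real
import Mathlib.Analysis.Real.Sqrt
import HarnessLib

/-!
# A graded symbol calculus for the derivatives of `e^{s(cos k - 1 + k²/2)}` and `e^{-s(1 - cos k)}`

Infrastructure for the proof of the named fact `SpreadOutIsing.srwGreen_asymp`
(`LaceExpansionIsingDeconvolutionParts.lean`: the classical asymptotics
`C_1(x) = a_d ⟦x⟧^{-(d-2)} + O(⟦x⟧^{-d})` of the lattice Green function of simple random walk,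
Liu–Slade 2026, (1.8); Lawler–Limic 2010, Thm. 4.3.1; Uchiyama 1998). That proof rests on a
weighted local central limit theorem for the continuous-time simple random walk, whose
one-dimensional core is the comparison of `∂_k^N e^{-s(1 - cos k)}` with `∂_k^N e^{-sk²/2}` near
`k = 0`, uniformly in `s ≥ 1`. Writing `e^{-s(1 - cos k)} = e^{-sk²/2} · e^{s r(k)}`,
`r(k) = cos k - 1 + k²/2 ∈ [0, k⁴/24]`, the derivatives `∂^j e^{s r} = e^{s r} F_j(s,k)` are
polynomials in `s` and the four atoms

  `u₁ = k - sin k = r'`, `u₂ = 1 - cos k = r''`, `u₃ = sin k`, `u₄ = cos k`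

(a differential algebra closed under `∂_k`: `u₁' = u₂`, `u₂' = u₃`, `u₃' = u₄`, `u₄' = -u₃`). In
the Gaussian scaling `k ∼ s^{-1/2}` the atoms have sizes `|u₁| ≤ |k|³`, `|u₂| ≤ k²`, `|u₃| ≤ |k|`,
`|u₄| ≤ 1` (`|k| ≤ 1`), so a monomial `c s^a u₁^{b₁} u₂^{b₂} u₃^{b₃} u₄^{b₄}` is bounded by
`|c| √s^{2a - q} (√s|k|)^q`, `q = 3b₁ + 2b₂ + b₃`. This file sets up the bookkeeping:

* `GoodSym n w F` — `F : ℝ → ℝ → ℝ` (a function of `(s, k)`) is a finite sum of monomials with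
  `s`-degree `a ≤ n` and *signed weight* `2a - q ≤ w`;
* closure: under sums and scalars, under multiplication by `s·u₁` (`n+1`, `w-1`) and by `s·u₃`
  (`n+1`, `w+1`), and under `∂_k` (`n`, `w+1`; `GoodSym.exists_hasDerivAt`);
* bounds: `|F(s,k)| ≤ C √s^w (1 + √s|k|)^Q` for `s ≥ 1`, `|k| ≤ 1` (`GoodSym.near_bound`), and
  `|F(s,k)| ≤ C s^n` for `s ≥ 1`, `|k| ≤ K` (`GoodSym.far_bound`).

The consequence used downstream (`SRWGreenHeatKernel1D.lean`): since `∂(e^{sr}F) = e^{sr}(s u₁ F + F')`,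
the symbol of `∂^j e^{sr}` lies in `GoodSym j (j-2)` for `j ≥ 1`, i.e. each derivative beyond
the Gaussian costs only `√s`, and the whole correction carries an extra factor `s^{-1}` — the
mechanism behind the sharp `O(⟦x⟧^{-d})` (rather than `O(⟦x⟧^{-(d-2+2/d)})`, which is what
Hara's Gaussian lemma, Hara 2008 Thm. 1.3, gives for a general kernel).

## References

* G. F. Lawler, V. Limic, *Random Walk: A Modern Introduction*, CUP 2010, Thm. 4.3.1 (Green
  function asymptotics with `O(|x|^{-d})` correction) and §2.3 (LCLT with error terms).
* K. Uchiyama, *Green's functions for random walks on `ℤ^N`*, Proc. LMS 77 (1998) 215–240, Thm. 2.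
* Y. Liu, G. Slade, *Gaussian deconvolution and the lace expansion for spread-out models*,
  Ann. Inst. H. Poincaré Probab. Statist. (2026), arXiv:2310.07640, (1.8).
-/

noncomputable section

namespace Literature.Barriers.CriticalPhenomena

namespace SRWGreen

open Real

/-! ### The four atoms -/

/-- `u₁(k) = k - sin k` (`= r'(k)` for `r = cos k - 1 + k²/2`). [folklore] -/
def u₁ (k : ℝ) : ℝ := k - Real.sin k

/-- `u₂(k) = 1 - cos k` (`= r''`). [folklore] -/
def u₂ (k : ℝ) : ℝ := 1 - Real.cos k

/-- `u₃(k) = sin k` (`= r'''`). [folklore] -/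
def u₃ (k : ℝ) : ℝ := Real.sin k

/-- `u₄(k) = cos k` (`= r''''`). [folklore] -/
def u₄ (k : ℝ) : ℝ := Real.cos k

/-- `u₁' = u₂`. [folklore] -/
theorem hasDerivAt_u₁ (k : ℝ) : HasDerivAt u₁ (u₂ k) k := by
  have h : HasDerivAt (fun x : ℝ => x - Real.sin x) (1 - Real.cos k) k :=
    (hasDerivAt_id k).sub (Real.hasDerivAt_sin k)
  exact h

/-- `u₂' = u₃`. [folklore] -/
theorem hasDerivAt_u₂ (k : ℝ) : HasDerivAt u₂ (u₃ k) k := by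
  have h : HasDerivAt (fun x : ℝ => (1 : ℝ) - Real.cos x) (0 - -Real.sin k) k :=
    (hasDerivAt_const k (1 : ℝ)).sub (Real.hasDerivAt_cos k)
  rw [zero_sub, neg_neg] at h
  exact h

/-- `u₃' = u₄`. [folklore] -/
theorem hasDerivAt_u₃ (k : ℝ) : HasDerivAt u₃ (u₄ k) k := Real.hasDerivAt_sin k

/-- `u₄' = -u₃`. [folklore] -/
theorem hasDerivAt_u₄ (k : ℝ) : HasDerivAt u₄ (-u₃ k) k := Real.hasDerivAt_cos k

/-- `|k - sin k| ≤ |k|³` for `|k| ≤ 1` (from Mathlib's `Real.sin_bound`). [folklore] -/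
theorem abs_u₁_le {k : ℝ} (hk : |k| ≤ 1) : |u₁ k| ≤ |k| ^ 3 := by
  have h := Real.sin_bound hk
  have h3 : 0 ≤ |k| ^ 3 := by positivity
  have h5 : |k| ^ 5 ≤ |k| ^ 3 := by
    calc |k| ^ 5 = |k| ^ 3 * |k| ^ 2 := by ring
      _ ≤ |k| ^ 3 * 1 := by
          refine mul_le_mul_of_nonneg_left ?_ h3
          calc |k| ^ 2 ≤ 1 ^ 2 := pow_le_pow_left₀ (abs_nonneg k) hk 2
            _ = 1 := one_pow 2
      _ = |k| ^ 3 := mul_one _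
  have hk3 : |k ^ 3 / 6| = |k| ^ 3 / 6 := by
    rw [abs_div, abs_pow, abs_of_pos (by norm_num : (0 : ℝ) < 6)]
  -- `k - sin k = -(sin k - (k - k³/6)) + k³/6`
  have heq : u₁ k = -(Real.sin k - (k - k ^ 3 / 6)) + k ^ 3 / 6 := by unfold u₁; ring
  rw [heq]
  calc |-(Real.sin k - (k - k ^ 3 / 6)) + k ^ 3 / 6|
      ≤ |-(Real.sin k - (k - k ^ 3 / 6))| + |k ^ 3 / 6| := abs_add_le _ _
    _ ≤ |k| ^ 5 / 100 + |k| ^ 3 / 6 := by rw [abs_neg, hk3]; exact add_le_add h le_rfl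
    _ ≤ |k| ^ 3 / 100 + |k| ^ 3 / 6 := by linarith
    _ ≤ |k| ^ 3 := by nlinarith

/-- `0 ≤ 1 - cos k ≤ k²` (indeed `≤ k²/2`). [folklore] -/
theorem abs_u₂_le (k : ℝ) : |u₂ k| ≤ |k| ^ 2 := by
  have h1 : 0 ≤ u₂ k := by unfold u₂; linarith [Real.cos_le_one k]
  have h2 : u₂ k ≤ k ^ 2 / 2 := by
    unfold u₂; linarith [Real.one_sub_sq_div_two_le_cos (x := k)]
  rw [abs_of_nonneg h1, sq_abs]
  nlinarith [sq_nonneg k]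

/-- `|sin k| ≤ |k|`. [folklore] -/
theorem abs_u₃_le (k : ℝ) : |u₃ k| ≤ |k| := Real.abs_sin_le_abs

/-- `|cos k| ≤ 1`. [folklore] -/
theorem abs_u₄_le (k : ℝ) : |u₄ k| ≤ 1 := Real.abs_cos_le_one k

/-- `|k - sin k| ≤ |k| + 1` for all `k`. [folklore] -/
theorem abs_u₁_le_add_one (k : ℝ) : |u₁ k| ≤ |k| + 1 := by
  unfold u₁
  calc |k - Real.sin k| ≤ |k| + |Real.sin k| := abs_sub _ _
    _ ≤ |k| + 1 := add_le_add le_rfl (Real.abs_sin_le_one k)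

/-- `|1 - cos k| ≤ 2`. [folklore] -/
theorem abs_u₂_le_two (k : ℝ) : |u₂ k| ≤ 2 := by
  unfold u₂
  rw [abs_le]
  constructor <;> linarith [Real.cos_le_one k, Real.neg_one_le_cos k]

/-- `|sin k| ≤ 1`. [folklore] -/
theorem abs_u₃_le_one (k : ℝ) : |u₃ k| ≤ 1 := Real.abs_sin_le_one k

/-! ### Monomials and the graded class `GoodSym n w` -/

/-- The monomial `c s^a u₁(k)^{b₁} u₂(k)^{b₂} u₃(k)^{b₃} u₄(k)^{b₄}`. [folklore] -/
def monom (c : ℝ) (a b₁ b₂ b₃ b₄ : ℕ) (s k : ℝ) : ℝ :=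
  c * s ^ a * u₁ k ^ b₁ * u₂ k ^ b₂ * u₃ k ^ b₃ * u₄ k ^ b₄

/-- **The graded symbol class.** `GoodSym n w F`: `F(s,k)` is a finite sum of monomials
`c s^a u₁^{b₁} u₂^{b₂} u₃^{b₃} u₄^{b₄}` with `a ≤ n` and signed weight
`2a - (3b₁ + 2b₂ + b₃) ≤ w`. [folklore] -/
inductive GoodSym (n : ℕ) (w : ℤ) : (ℝ → ℝ → ℝ) → Prop
  | zero : GoodSym n w (fun _ _ => 0)
  | term (c : ℝ) (a b₁ b₂ b₃ b₄ : ℕ) (ha : a ≤ n)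
      (hw : 2 * (a : ℤ) - ((3 * b₁ + 2 * b₂ + b₃ : ℕ) : ℤ) ≤ w) :
      GoodSym n w (monom c a b₁ b₂ b₃ b₄)
  | add (F G : ℝ → ℝ → ℝ) : GoodSym n w F → GoodSym n w G → GoodSym n w (fun s k => F s k + G s k)

namespace GoodSym

variable {n : ℕ} {w : ℤ} {F G : ℝ → ℝ → ℝ}

/-- Monotonicity in the indices. [folklore] -/
theorem weaken (h : GoodSym n w F) {n' : ℕ} {w' : ℤ} (hn : n ≤ n') (hw : w ≤ w') :
    GoodSym n' w' F := by
  induction h with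
  | zero => exact GoodSym.zero
  | term c a b₁ b₂ b₃ b₄ ha hw' => exact GoodSym.term c a b₁ b₂ b₃ b₄ (ha.trans hn) (hw'.trans hw)
  | add F G _ _ ihF ihG => exact GoodSym.add F G ihF ihG

/-- Closure under scalar multiplication. [folklore] -/
theorem const_mul (h : GoodSym n w F) (c : ℝ) : GoodSym n w (fun s k => c * F s k) := by
  induction h with
  | zero => simpa using (GoodSym.zero : GoodSym n w _)
  | term c' a b₁ b₂ b₃ b₄ ha hw =>
    have : (fun s k => c * monom c' a b₁ b₂ b₃ b₄ s k) = monom (c * c') a b₁ b₂ b₃ b₄ := by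
      funext s k; unfold monom; ring
    rw [this]; exact GoodSym.term _ a b₁ b₂ b₃ b₄ ha hw
  | add F G _ _ ihF ihG =>
    have : (fun s k => c * (F s k + G s k)) = fun s k => c * F s k + c * G s k := by
      funext s k; ring
    rw [this]; exact GoodSym.add _ _ ihF ihG

/-- Closure under negation. [folklore] -/
theorem neg (h : GoodSym n w F) : GoodSym n w (fun s k => -F s k) := by
  simpa using h.const_mul (-1)

/-- Closure under subtraction. [folklore] -/
theorem sub (hF : GoodSym n w F) (hG : GoodSym n w G) : GoodSym n w (fun s k => F s k - G s k) := by
  simpa [sub_eq_add_neg] using GoodSym.add _ _ hF hG.neg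

/-- Multiplication by `s · u₁(k)` (the factor `s r'` produced by differentiating `e^{s r}`):
`s`-degree `+1`, weight `-1`. [folklore] -/
theorem mul_s_u₁ (h : GoodSym n w F) : GoodSym (n + 1) (w - 1) (fun s k => s * u₁ k * F s k) := by
  induction h with
  | zero => simpa using (GoodSym.zero : GoodSym (n + 1) (w - 1) _)
  | term c a b₁ b₂ b₃ b₄ ha hw =>
    have : (fun s k => s * u₁ k * monom c a b₁ b₂ b₃ b₄ s k) = monom c (a + 1) (b₁ + 1) b₂ b₃ b₄ := by
      funext s k; unfold monom; ring
    rw [this]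
    refine GoodSym.term c (a + 1) (b₁ + 1) b₂ b₃ b₄ (by omega) ?_
    push_cast at hw ⊢; omega
  | add F G _ _ ihF ihG =>
    have : (fun s k => s * u₁ k * (F s k + G s k)) =
        fun s k => s * u₁ k * F s k + s * u₁ k * G s k := by
      funext s k; ring
    rw [this]; exact GoodSym.add _ _ ihF ihG

/-- Multiplication by `s · u₃(k)` (the factor `s sin k` produced by differentiating
`e^{-s(1 - cos k)}`): `s`-degree `+1`, weight `+1`. [folklore] -/
theorem mul_s_u₃ (h : GoodSym n w F) : GoodSym (n + 1) (w + 1) (fun s k => s * u₃ k * F s k) := by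
  induction h with
  | zero => simpa using (GoodSym.zero : GoodSym (n + 1) (w + 1) _)
  | term c a b₁ b₂ b₃ b₄ ha hw =>
    have : (fun s k => s * u₃ k * monom c a b₁ b₂ b₃ b₄ s k) = monom c (a + 1) b₁ b₂ (b₃ + 1) b₄ := by
      funext s k; unfold monom; ring
    rw [this]
    refine GoodSym.term c (a + 1) b₁ b₂ (b₃ + 1) b₄ (by omega) ?_
    push_cast at hw ⊢; omega
  | add F G _ _ ihF ihG =>
    have : (fun s k => s * u₃ k * (F s k + G s k)) =
        fun s k => s * u₃ k * F s k + s * u₃ k * G s k := by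
      funext s k; ring
    rw [this]; exact GoodSym.add _ _ ihF ihG

/-- The derivative of a monomial is a sum of four monomials, each of weight `≤ w + 1`.
[folklore] -/
theorem hasDerivAt_mono (c : ℝ) (a b₁ b₂ b₃ b₄ : ℕ) (s k : ℝ) :
    HasDerivAt (fun k => monom c a b₁ b₂ b₃ b₄ s k)
      (monom (c * b₁) a (b₁ - 1) (b₂ + 1) b₃ b₄ s k + monom (c * b₂) a b₁ (b₂ - 1) (b₃ + 1) b₄ s k +
        monom (c * b₃) a b₁ b₂ (b₃ - 1) (b₄ + 1) s k + monom (-(c * b₄)) a b₁ b₂ (b₃ + 1) (b₄ - 1) s k) k := by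
  have h1 := (hasDerivAt_u₁ k).pow b₁
  have h2 := (hasDerivAt_u₂ k).pow b₂
  have h3 := (hasDerivAt_u₃ k).pow b₃
  have h4 := (hasDerivAt_u₄ k).pow b₄
  have h := (((h1.const_mul (c * s ^ a)).mul h2).mul h3).mul h4
  refine h.congr_deriv ?_
  simp only [Pi.mul_apply, Pi.pow_apply]
  unfold monom
  ring

/-- **Closure under `∂_k`**: every `F ∈ GoodSym n w` has a `k`-derivative `F' ∈ GoodSym n (w+1)`.
[folklore] -/
theorem exists_hasDerivAt (h : GoodSym n w F) :
    ∃ F' : ℝ → ℝ → ℝ, GoodSym n (w + 1) F' ∧ ∀ s k, HasDerivAt (fun k => F s k) (F' s k) k := by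
  induction h with
  | zero => exact ⟨fun _ _ => 0, GoodSym.zero, fun s k => hasDerivAt_const k 0⟩
  | term c a b₁ b₂ b₃ b₄ ha hw =>
    refine ⟨fun s k => monom (c * b₁) a (b₁ - 1) (b₂ + 1) b₃ b₄ s k +
        monom (c * b₂) a b₁ (b₂ - 1) (b₃ + 1) b₄ s k +
        monom (c * b₃) a b₁ b₂ (b₃ - 1) (b₄ + 1) s k +
        monom (-(c * b₄)) a b₁ b₂ (b₃ + 1) (b₄ - 1) s k, ?_, fun s k => hasDerivAt_mono c a b₁ b₂ b₃ b₄ s k⟩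
    refine GoodSym.add _ _ (GoodSym.add _ _ (GoodSym.add _ _ ?_ ?_) ?_) ?_
    · refine GoodSym.term _ a _ _ _ _ ha ?_
      push_cast at hw ⊢; omega
    · refine GoodSym.term _ a _ _ _ _ ha ?_
      push_cast at hw ⊢; omega
    · refine GoodSym.term _ a _ _ _ _ ha ?_
      push_cast at hw ⊢; omega
    · refine GoodSym.term _ a _ _ _ _ ha ?_
      push_cast at hw ⊢; omega
  | add F G _ _ ihF ihG =>
    obtain ⟨F', hF', hF'd⟩ := ihF
    obtain ⟨G', hG', hG'd⟩ := ihG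
    exact ⟨fun s k => F' s k + G' s k, GoodSym.add _ _ hF' hG', fun s k => (hF'd s k).add (hG'd s k)⟩

/-- Continuity in `k`. [folklore] -/
theorem continuous (h : GoodSym n w F) (s : ℝ) : Continuous fun k => F s k := by
  obtain ⟨F', -, hF'⟩ := h.exists_hasDerivAt
  exact continuous_iff_continuousAt.2 fun k => (hF' s k).continuousAt

/-! ### Bounds -/

/-- The monomial bound in the Gaussian scaling: for `s ≥ 1`, `|k| ≤ 1`,
`|c s^a u₁^{b₁} u₂^{b₂} u₃^{b₃} u₄^{b₄}| ≤ |c| √s^{2a-q} (1 + √s|k|)^q`, `q = 3b₁ + 2b₂ + b₃`.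
[folklore] -/
theorem abs_mono_le (c : ℝ) (a b₁ b₂ b₃ b₄ : ℕ) {s k : ℝ} (hs : 1 ≤ s) (hk : |k| ≤ 1) :
    |monom c a b₁ b₂ b₃ b₄ s k| ≤
      |c| * Real.sqrt s ^ (2 * (a : ℤ) - ((3 * b₁ + 2 * b₂ + b₃ : ℕ) : ℤ)) *
        (1 + Real.sqrt s * |k|) ^ (3 * b₁ + 2 * b₂ + b₃) := by
  set q : ℕ := 3 * b₁ + 2 * b₂ + b₃ with hq
  have hs0 : 0 ≤ s := by linarith
  have hr1 : 1 ≤ Real.sqrt s := Real.one_le_sqrt.2 hs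
  have hr0 : 0 < Real.sqrt s := by linarith
  have hk0 : 0 ≤ |k| := abs_nonneg k
  -- `|monom| ≤ |c| s^a |k|^q`
  have h1 : |monom c a b₁ b₂ b₃ b₄ s k| ≤ |c| * s ^ a * |k| ^ q := by
    unfold monom
    rw [abs_mul, abs_mul, abs_mul, abs_mul, abs_mul, abs_pow, abs_pow, abs_pow, abs_pow, abs_pow,
      abs_of_nonneg hs0]
    have e1 : |u₁ k| ^ b₁ ≤ (|k| ^ 3) ^ b₁ := pow_le_pow_left₀ (abs_nonneg _) (abs_u₁_le hk) b₁
    have e2 : |u₂ k| ^ b₂ ≤ (|k| ^ 2) ^ b₂ := pow_le_pow_left₀ (abs_nonneg _) (abs_u₂_le k) b₂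
    have e3 : |u₃ k| ^ b₃ ≤ |k| ^ b₃ := pow_le_pow_left₀ (abs_nonneg _) (abs_u₃_le k) b₃
    have e4 : |u₄ k| ^ b₄ ≤ (1 : ℝ) ^ b₄ := pow_le_pow_left₀ (abs_nonneg _) (abs_u₄_le k) b₄
    rw [one_pow] at e4
    have hcs : 0 ≤ |c| * s ^ a := by positivity
    calc |c| * s ^ a * |u₁ k| ^ b₁ * |u₂ k| ^ b₂ * |u₃ k| ^ b₃ * |u₄ k| ^ b₄
        ≤ |c| * s ^ a * (|k| ^ 3) ^ b₁ * (|k| ^ 2) ^ b₂ * |k| ^ b₃ * 1 := by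
          gcongr
      _ = |c| * s ^ a * |k| ^ q := by rw [hq]; ring
  -- `s^a |k|^q = √s^{2a-q} (√s |k|)^q`
  have h2 : Real.sqrt s ^ (2 * (a : ℤ) - (q : ℤ)) * (Real.sqrt s * |k|) ^ q = s ^ a * |k| ^ q := by
    rw [mul_pow, ← mul_assoc]
    congr 1
    rw [zpow_sub₀ hr0.ne', zpow_natCast, div_mul_cancel₀ _ (pow_ne_zero _ hr0.ne'), zpow_mul, zpow_two,
      Real.mul_self_sqrt hs0, zpow_natCast]
  -- `√s^{2a-q} ≤ √s^{w}` is not needed here; bound `(√s|k|)^q ≤ (1 + √s|k|)^q`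
  have h3 : (Real.sqrt s * |k|) ^ q ≤ (1 + Real.sqrt s * |k|) ^ q :=
    pow_le_pow_left₀ (by positivity) (by linarith [mul_nonneg hr0.le hk0]) q
  calc |monom c a b₁ b₂ b₃ b₄ s k| ≤ |c| * s ^ a * |k| ^ q := h1
    _ = |c| * (Real.sqrt s ^ (2 * (a : ℤ) - (q : ℤ)) * (Real.sqrt s * |k|) ^ q) := by rw [h2]; ring
    _ ≤ |c| * (Real.sqrt s ^ (2 * (a : ℤ) - (q : ℤ)) * (1 + Real.sqrt s * |k|) ^ q) := by
        refine mul_le_mul_of_nonneg_left (mul_le_mul_of_nonneg_left h3 (zpow_nonneg hr0.le _)) (abs_nonneg c)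
    _ = _ := by rw [hq]; ring

/-- **Near bound**: for `F ∈ GoodSym n w` there are `C ≥ 0` and `Q` with
`|F(s,k)| ≤ C √s^w (1 + √s|k|)^Q` for all `s ≥ 1`, `|k| ≤ 1`. [folklore] -/
theorem near_bound (h : GoodSym n w F) :
    ∃ C : ℝ, 0 ≤ C ∧ ∃ Q : ℕ, ∀ s : ℝ, 1 ≤ s → ∀ k : ℝ, |k| ≤ 1 →
      |F s k| ≤ C * Real.sqrt s ^ w * (1 + Real.sqrt s * |k|) ^ Q := by
  induction h with
  | zero => exact ⟨0, le_rfl, 0, fun s _ k _ => by simp⟩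
  | term c a b₁ b₂ b₃ b₄ ha hw =>
    refine ⟨|c|, abs_nonneg c, 3 * b₁ + 2 * b₂ + b₃, fun s hs k hk => ?_⟩
    have hr1 : 1 ≤ Real.sqrt s := Real.one_le_sqrt.2 hs
    have hx : 0 ≤ Real.sqrt s * |k| := mul_nonneg (by linarith) (abs_nonneg k)
    calc |monom c a b₁ b₂ b₃ b₄ s k|
        ≤ |c| * Real.sqrt s ^ (2 * (a : ℤ) - ((3 * b₁ + 2 * b₂ + b₃ : ℕ) : ℤ)) *
            (1 + Real.sqrt s * |k|) ^ (3 * b₁ + 2 * b₂ + b₃) := abs_mono_le c a b₁ b₂ b₃ b₄ hs hk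
      _ ≤ |c| * Real.sqrt s ^ w * (1 + Real.sqrt s * |k|) ^ (3 * b₁ + 2 * b₂ + b₃) := by
          refine mul_le_mul_of_nonneg_right (mul_le_mul_of_nonneg_left ?_ (abs_nonneg c))
            (pow_nonneg (by linarith) _)
          exact zpow_le_zpow_right₀ hr1 hw
  | add F G _ _ ihF ihG =>
    obtain ⟨C₁, hC₁, Q₁, h₁⟩ := ihF
    obtain ⟨C₂, hC₂, Q₂, h₂⟩ := ihG
    refine ⟨C₁ + C₂, add_nonneg hC₁ hC₂, max Q₁ Q₂, fun s hs k hk => ?_⟩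
    have hr1 : 1 ≤ Real.sqrt s := Real.one_le_sqrt.2 hs
    have hx1 : 1 ≤ 1 + Real.sqrt s * |k| := by
      have : 0 ≤ Real.sqrt s * |k| := mul_nonneg (by linarith) (abs_nonneg k)
      linarith
    have hzw : 0 ≤ Real.sqrt s ^ w := zpow_nonneg (by linarith) _
    have e1 : (1 + Real.sqrt s * |k|) ^ Q₁ ≤ (1 + Real.sqrt s * |k|) ^ max Q₁ Q₂ :=
      pow_le_pow_right₀ hx1 (le_max_left _ _)
    have e2 : (1 + Real.sqrt s * |k|) ^ Q₂ ≤ (1 + Real.sqrt s * |k|) ^ max Q₁ Q₂ :=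
      pow_le_pow_right₀ hx1 (le_max_right _ _)
    calc |F s k + G s k| ≤ |F s k| + |G s k| := abs_add_le _ _
      _ ≤ C₁ * Real.sqrt s ^ w * (1 + Real.sqrt s * |k|) ^ Q₁ +
            C₂ * Real.sqrt s ^ w * (1 + Real.sqrt s * |k|) ^ Q₂ := add_le_add (h₁ s hs k hk) (h₂ s hs k hk)
      _ ≤ C₁ * Real.sqrt s ^ w * (1 + Real.sqrt s * |k|) ^ max Q₁ Q₂ +
            C₂ * Real.sqrt s ^ w * (1 + Real.sqrt s * |k|) ^ max Q₁ Q₂ := by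
          gcongr
      _ = (C₁ + C₂) * Real.sqrt s ^ w * (1 + Real.sqrt s * |k|) ^ max Q₁ Q₂ := by ring

/-- **Far bound**: for `F ∈ GoodSym n w` and `K ≥ 0` there is `C ≥ 0` with `|F(s,k)| ≤ C s^n` for
all `s ≥ 1`, `|k| ≤ K`. [folklore] -/
theorem far_bound (h : GoodSym n w F) {K : ℝ} (hK : 0 ≤ K) :
    ∃ C : ℝ, 0 ≤ C ∧ ∀ s : ℝ, 1 ≤ s → ∀ k : ℝ, |k| ≤ K → |F s k| ≤ C * s ^ n := by
  induction h with
  | zero => exact ⟨0, le_rfl, fun s _ k _ => by simp⟩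
  | term c a b₁ b₂ b₃ b₄ ha hw =>
    refine ⟨|c| * (K + 1) ^ b₁ * 2 ^ b₂, by positivity, fun s hs k hk => ?_⟩
    have hs0 : 0 ≤ s := by linarith
    unfold monom
    rw [abs_mul, abs_mul, abs_mul, abs_mul, abs_mul, abs_pow, abs_pow, abs_pow, abs_pow, abs_pow,
      abs_of_nonneg hs0]
    have e1 : |u₁ k| ^ b₁ ≤ (K + 1) ^ b₁ :=
      pow_le_pow_left₀ (abs_nonneg _) ((abs_u₁_le_add_one k).trans (by linarith)) b₁
    have e2 : |u₂ k| ^ b₂ ≤ (2 : ℝ) ^ b₂ := pow_le_pow_left₀ (abs_nonneg _) (abs_u₂_le_two k) b₂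
    have e3 : |u₃ k| ^ b₃ ≤ (1 : ℝ) ^ b₃ := pow_le_pow_left₀ (abs_nonneg _) (abs_u₃_le_one k) b₃
    have e4 : |u₄ k| ^ b₄ ≤ (1 : ℝ) ^ b₄ := pow_le_pow_left₀ (abs_nonneg _) (abs_u₄_le k) b₄
    rw [one_pow] at e3 e4
    have e0 : s ^ a ≤ s ^ n := pow_le_pow_right₀ hs ha
    calc |c| * s ^ a * |u₁ k| ^ b₁ * |u₂ k| ^ b₂ * |u₃ k| ^ b₃ * |u₄ k| ^ b₄
        ≤ |c| * s ^ n * (K + 1) ^ b₁ * 2 ^ b₂ * 1 * 1 := by gcongr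
      _ = |c| * (K + 1) ^ b₁ * 2 ^ b₂ * s ^ n := by ring
  | add F G _ _ ihF ihG =>
    obtain ⟨C₁, hC₁, h₁⟩ := ihF
    obtain ⟨C₂, hC₂, h₂⟩ := ihG
    refine ⟨C₁ + C₂, add_nonneg hC₁ hC₂, fun s hs k hk => ?_⟩
    calc |F s k + G s k| ≤ |F s k| + |G s k| := abs_add_le _ _
      _ ≤ C₁ * s ^ n + C₂ * s ^ n := add_le_add (h₁ s hs k hk) (h₂ s hs k hk)
      _ = (C₁ + C₂) * s ^ n := by ring

end GoodSym

/-- The constant symbol `1` lies in `GoodSym 0 0`. [folklore] -/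
theorem goodSym_one : GoodSym 0 0 (fun _ _ => (1 : ℝ)) := by
  have : (fun _ _ => (1 : ℝ)) = monom 1 0 0 0 0 0 := by funext s k; unfold monom; ring
  rw [this]
  exact GoodSym.term 1 0 0 0 0 0 le_rfl (by norm_num)

/-- The symbol `s·u₁(k)` (`= s r'(k)`, the symbol of `∂ e^{s r}`) lies in `GoodSym 1 (-1)`. [folklore] -/
theorem goodSym_s_u₁ : GoodSym 1 (-1) (fun s k => s * u₁ k) := by
  have : (fun s k => s * u₁ k) = monom 1 1 1 0 0 0 := by funext s k; unfold monom; ring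
  rw [this]
  exact GoodSym.term 1 1 1 0 0 0 le_rfl (by norm_num)

end SRWGreen

end Literature.Barriers.CriticalPhenomena

end
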